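import Summits.CriticalPhenomena.PercolationContinuityZ3.Theorems.PercNearOneGluingNoHeavyQuantBlockCombTiedPlusRoot
import HarnessLib

/-!
# QUANT lane R8, FAR on trees: the block-comb tail is AFFINE in the first chain gate; the affine slide that ties the lightest root carrier

builds on p205010 (kernel theorem, internal audit signed; external expert review pending)

Support file (`--supports stmt-CriticalPhenomena-4575`), QUANT lane seat prim-quant-census-2 (gen 48); memo
`run/shared/lean/prim/quant/prim-quant-census-2-g48/TIED-PLUS-TWO-G48.md` §2 (A2).  Theorems only (local notation, no definitions), no sorries, standard
axioms.  Model/notation: `…QuantBlockCombMergeModel.lean`; used by `…QuantBlockCombTiedPlusTwo.lean` (FAR for every block-comb all-tied except two blocks).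

* `Quant.BlockComb.tail_root_split_eq` / `tail_update_rootGate` — the ROOT SPLIT as an identity: `TAIL[D+1, q] = (1 − q 0)·Φ₀ + q 0·Ψ` with
  `Φ₀ = Σ_S wt S·𝟙[root mass of S ≥ j+1]` (the root blobs alone cross) and `Ψ = TAIL[D, q ∘ succ, lv − 1]` (the contracted instance, which does not
  see the first gate); hence `TAIL[update q 0 t] = (1 − t)·Φ₀ + t·Ψ` for every real `t`.  (Lead g13's `tail_succ_ge_rootGate_mul` drops the first
  term; `tail_contract_root` is the case `Φ₀ = 0`.)
* `Quant.BlockComb.tail_ge_of_slide_to_tied` — **the affine slide.**  Chain of `D+1` gates, `x = ∏ q > 0`; two blobs `r, s`; every other live blob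
  tied at `x` and below the root; `r` a live ROOT blob with `x ≤ g r` and `q 0·g r < x` (lighter than the deep private gates), not heavier than `s` if
  `s` is a live root blob; `s` (if live) with marginal `≥ x`; budget `2j < Σ a·marginal`.  Then `x ≤ TAIL`.  Proof: at first gate `t = q 0·g r/x ∈ [q 0, 1)`
  the blob `r` is TIED at the new floor `x' = g r`, everything else stays tied/heavy and the budget does not drop, so `x' ≤ TAIL[update q 0 t]` by lead
  g13's ONE-block theorem `tail_ge_of_tied_plus_one` (p246017) — or by `tail_ge_of_class` if `s` is dead; and
  `TAIL[update q 0 t] − x' = Φ₀ + (t/q 0)·(TAIL[q] − Φ₀ − x)`: either the bracket is `≥ 0` (then `TAIL[q] ≥ Φ₀ + x ≥ x`) or the left side is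
  non-increasing in `t ≥ q 0` and `TAIL[q] − x ≥ TAIL[update q 0 t] − x' ≥ 0`.  This strengthens lead g13's normal form (LEAD-NOTES-G13 N24 (1): 'least
  reliable ROOT blob tied', proved there under root mass `≤ j`, i.e. `Φ₀ = 0`) to every root mass, which is what removes N24 (9)'s corner
  'both carriers at the root with a₀ + a₁ ≥ j+1'.
[this work]
-/

namespace Summit.CriticalPhenomena.PercolationContinuityZ3.Theorems

namespace Quant

namespace BlockComb

open Finset

variable {κ : Type*} [Fintype κ] [DecidableEq κ]

/-- product-Bernoulli weight of the set `S` of open blob gates -/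
local notation3 "wt[" g ", " S "]" => ∏ k, (if k ∈ (S : Finset κ) then (g : κ → ℝ) k else 1 - (g : κ → ℝ) k)

/-- probability that the chain `q` of length `D` is open exactly to depth `i` -/
local notation3 "pd[" D ", " q ", " i "]" =>
  (∏ i' ∈ Finset.range (i : ℕ), (q : ℕ → ℝ) i') * (if (i : ℕ) < (D : ℕ) then 1 - (q : ℕ → ℝ) i else 1)

/-- mass counted at depth `i` in blob configuration `S` -/
local notation3 "mass[" lv ", " a ", " i ", " S "]" =>
  ∑ k ∈ (S : Finset κ).filter (fun k => (lv : κ → ℕ) k ≤ (i : ℕ)), ((a : κ → ℕ) k : ℕ)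

/-- the tail `P(N ≥ j+1)` of the block-comb count, as an explicit finite sum -/
local notation3 "TAIL[" D ", " q ", " lv ", " a ", " g ", " j "]" =>
  ∑ i ∈ Finset.range ((D : ℕ) + 1), pd[D, q, i] *
    ∑ S : Finset κ, wt[g, S] * (if (j : ℕ) + 1 ≤ mass[lv, a, i, S] then (1 : ℝ) else 0)

/-- the root-level crossing probability `Φ₀ = Σ_S wt S·𝟙[j+1 ≤ root mass of S]` (the chain closed at its first gate) -/
local notation3 "ROOT[" lv ", " a ", " g ", " j "]" =>
  ∑ S : Finset κ, wt[g, S] * (if (j : ℕ) + 1 ≤ mass[lv, a, 0, S] then (1 : ℝ) else 0)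

/-! ### 1. The root split as an identity: the tail is affine in the first chain gate -/

/-- **Root split (identity).**  `TAIL[D+1, q] = (1 − q 0)·Φ₀ + q 0·TAIL[D, q ∘ succ]` with all levels lowered by one (natural subtraction keeps
the root blobs at level `0`); `Φ₀` = the root blobs alone crossing.  (Lead g13's `tail_succ_ge_rootGate_mul` is this identity with the first term
dropped; the depth bookkeeping below is adapted from it.) [this work] -/
theorem tail_root_split_eq (D : ℕ) (q : ℕ → ℝ) (lv : κ → ℕ) (a : κ → ℕ) (g : κ → ℝ) (j : ℕ) :
    TAIL[D + 1, q, lv, a, g, j] =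
      (1 - q 0) * ROOT[lv, a, g, j] + q 0 * TAIL[D, (fun i => q (i + 1)), (fun k => lv k - 1), a, g, j] := by
  rw [Finset.sum_range_succ']
  have hpd0 : pd[D + 1, q, 0] = 1 - q 0 := by
    show (∏ i' ∈ Finset.range 0, q i') * (if 0 < D + 1 then 1 - q 0 else 1) = 1 - q 0
    rw [Finset.prod_range_zero, one_mul, if_pos (Nat.succ_pos D)]
  have hrest : ∑ i ∈ Finset.range (D + 1), pd[D + 1, q, i + 1] *
      ∑ S : Finset κ, wt[g, S] * (if j + 1 ≤ mass[lv, a, i + 1, S] then (1 : ℝ) else 0) =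
        q 0 * TAIL[D, (fun i => q (i + 1)), (fun k => lv k - 1), a, g, j] := by
    rw [Finset.mul_sum]
    refine Finset.sum_congr rfl fun i hi => ?_
    have hpd : pd[D + 1, q, i + 1] = q 0 * pd[D, (fun i => q (i + 1)), i] := by
      show (∏ i' ∈ Finset.range (i + 1), q i') * (if i + 1 < D + 1 then 1 - q (i + 1) else 1) =
        q 0 * ((∏ i' ∈ Finset.range i, q (i' + 1)) * (if i < D then 1 - q (i + 1) else 1))
      rw [Finset.prod_range_succ']
      by_cases hi' : i < D
      · rw [if_pos hi', if_pos (by omega)]; ring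
      · rw [if_neg hi', if_neg (by omega)]; ring
    have hmass : ∀ S : Finset κ, mass[lv, a, i + 1, S] = mass[(fun k => lv k - 1), a, i, S] := by
      intro S
      refine Finset.sum_congr ?_ fun _ _ => rfl
      ext k
      simp only [Finset.mem_filter]
      constructor
      · rintro ⟨hk, hle⟩; exact ⟨hk, by omega⟩
      · rintro ⟨hk, hle⟩; exact ⟨hk, by omega⟩
    rw [hpd, mul_assoc]
    congr 1
    congr 1
    exact Finset.sum_congr rfl fun S _ => by rw [hmass S]
  rw [hrest, hpd0]
  ring

/-- **The tail is affine in the first chain gate**: `TAIL[D+1, update q 0 t] = (1 − t)·Φ₀ + t·TAIL[D, q ∘ succ, lv − 1]` for every real `t`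
(the contracted tail does not see the first gate). [this work] -/
theorem tail_update_rootGate (D : ℕ) (q : ℕ → ℝ) (lv : κ → ℕ) (a : κ → ℕ) (g : κ → ℝ) (j : ℕ) (t : ℝ) :
    TAIL[D + 1, Function.update q 0 t, lv, a, g, j] =
      (1 - t) * ROOT[lv, a, g, j] + t * TAIL[D, (fun i => q (i + 1)), (fun k => lv k - 1), a, g, j] := by
  have hq : (fun i => Function.update q 0 t (i + 1)) = fun i => q (i + 1) :=
    funext fun i => Function.update_of_ne (Nat.succ_ne_zero i) t q
  have h := tail_root_split_eq D (Function.update q 0 t) lv a g j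
  rw [Function.update_self, hq] at h
  exact h

/-- The root-level crossing probability is nonnegative. [folklore] -/
theorem root_nonneg (lv : κ → ℕ) (a : κ → ℕ) (g : κ → ℝ) (hg : ∀ k, 0 ≤ g k ∧ g k ≤ 1) (j : ℕ) :
    0 ≤ ROOT[lv, a, g, j] :=
  Finset.sum_nonneg fun S _ => mul_nonneg (wt_nonneg g hg S) (by split_ifs <;> norm_num)

/-! ### 2. The affine slide -/

/-- **The affine slide (ties the lightest root carrier).**  Chain of `D+1` gates, `x = ∏_{i ≤ D} q i > 0`; two blobs `r ≠ s`; every live blob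
other than `r, s` is TIED at `x` and none of them sits at the root; `r` is a live ROOT blob with `x ≤ g r` and `q 0·g r < x` (lighter than the
deep private gates); `s`, if live, has marginal `≥ x`, and if `s` is a live root blob then `g r ≤ g s`; budget `2j < Σ_k a k·marginal k`.  Then
`x ≤ TAIL`.  Proof: with first gate `t = q 0·g r/x ∈ [q 0, 1)` the blob `r` is tied at the new floor `x' = g r = (t/q 0)·x`, every other tied
blob stays tied, `s` stays heavy, the budget does not drop, so `x' ≤ TAIL[update q 0 t]` (`tail_ge_of_tied_plus_one`, or `tail_ge_of_class` if
`s` is dead); and by `tail_update_rootGate`, `TAIL[update q 0 t] − x' = Φ₀ + (t/q 0)·(TAIL[q] − Φ₀ − x)`, so either `TAIL[q] − Φ₀ − x ≥ 0`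
(and `TAIL[q] ≥ x` since `Φ₀ ≥ 0`) or the left side decreases in `t ≥ q 0` and `TAIL[q] − x ≥ TAIL[update q 0 t] − x' ≥ 0`. [this work] -/
theorem tail_ge_of_slide_to_tied (D : ℕ) (q : ℕ → ℝ) (hq : ∀ i, 0 ≤ q i ∧ q i ≤ 1) (lv : κ → ℕ) (a : κ → ℕ)
    (g : κ → ℝ) (hg : ∀ k, 0 ≤ g k ∧ g k ≤ 1) (j : ℕ) (hlv : ∀ k, 0 < a k → lv k ≤ D + 1)
    (r s : κ) (x : ℝ) (hx0 : 0 < x) (hxq : x = ∏ i ∈ Finset.range (D + 1), q i)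
    (htied : ∀ k, 0 < a k → k ≠ r → k ≠ s → (∏ i ∈ Finset.range (lv k), q i) * g k = x)
    (hroot : ∀ k, 0 < a k → lv k = 0 → k = r ∨ k = s)
    (hr : 0 < a r) (hr0 : lv r = 0) (hrx : x ≤ g r) (hlight : q 0 * g r < x)
    (hs : 0 < a s → x ≤ (∏ i ∈ Finset.range (lv s), q i) * g s)
    (hs' : 0 < a s → lv s = 0 → g r ≤ g s)
    (hbudget : (2 * j : ℝ) < ∑ k, (a k : ℝ) * ((∏ i ∈ Finset.range (lv k), q i) * g k)) :
    x ≤ TAIL[D + 1, q, lv, a, g, j] := by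
  -- the first gate is positive and `x = q 0 · P`
  set P : ℝ := ∏ i ∈ Finset.range D, q (i + 1) with hPdef
  have hxP : x = q 0 * P := by rw [hxq, prefixProd_succ]
  have hP0 : 0 ≤ P := Finset.prod_nonneg fun i _ => (hq (i + 1)).1
  have hq0 : 0 < q 0 := by
    rcases (hq 0).1.lt_or_eq with h | h
    · exact h
    · exfalso; rw [hxP, ← h, zero_mul] at hx0; exact lt_irrefl _ hx0
  have hPpos : 0 < P := by
    rcases hP0.lt_or_eq with h | h
    · exact h
    · exfalso; rw [hxP, ← h, mul_zero] at hx0; exact lt_irrefl _ hx0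
  have hgr0 : 0 < g r := hx0.trans_le hrx
  -- the new first gate
  set t : ℝ := q 0 * g r / x with htdef
  have htx : t * x = q 0 * g r := by rw [htdef]; field_simp
  have ht0 : 0 < t := by rw [htdef]; exact div_pos (mul_pos hq0 hgr0) hx0
  have ht1 : t ≤ 1 := by rw [htdef, div_le_one hx0]; exact hlight.le
  have htq : q 0 ≤ t := by
    rw [htdef, le_div_iff₀ hx0]
    exact mul_le_mul_of_nonneg_left hrx (hq 0).1
  have htP : t * P = g r := by
    have h1 : t * P * q 0 = g r * q 0 := by
      calc t * P * q 0 = t * (q 0 * P) := by ring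
        _ = t * x := by rw [hxP]
        _ = q 0 * g r := htx
        _ = g r * q 0 := by ring
    exact mul_right_cancel₀ hq0.ne' h1
  set q' : ℕ → ℝ := Function.update q 0 t with hq'def
  have hq' : ∀ i, 0 ≤ q' i ∧ q' i ≤ 1 := by
    intro i
    by_cases hi : i = 0
    · rw [hi, hq'def, Function.update_self]; exact ⟨ht0.le, ht1⟩
    · rw [hq'def, Function.update_of_ne hi]; exact hq i
  -- prefix products along `q'`
  have hpre0 : ∀ k, lv k = 0 → (∏ i ∈ Finset.range (lv k), q' i) * g k = g k := fun k hk => by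
    rw [hk, Finset.prod_range_zero, one_mul]
  have hpre0q : ∀ k, lv k = 0 → (∏ i ∈ Finset.range (lv k), q i) * g k = g k := fun k hk => by
    rw [hk, Finset.prod_range_zero, one_mul]
  have hpre1 : ∀ k m, lv k = m + 1 →
      (∏ i ∈ Finset.range (lv k), q' i) * g k = t * ((∏ i ∈ Finset.range m, q (i + 1)) * g k) := fun k m hk => by
    rw [hk, hq'def, prefixProd_update_succ]; ring
  have hpre1q : ∀ k m, lv k = m + 1 →
      (∏ i ∈ Finset.range (lv k), q i) * g k = q 0 * ((∏ i ∈ Finset.range m, q (i + 1)) * g k) := fun k m hk => by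
    rw [hk, prefixProd_succ]; ring
  -- the new floor `x' = g r = ∏ q'`
  have hx'q : g r = ∏ i ∈ Finset.range (D + 1), q' i := by
    rw [hq'def, prefixProd_update_succ, ← hPdef, htP]
  -- every marginal can only grow, and a deep marginal is multiplied by `t / q 0`
  have hmarg_mono : ∀ k, (∏ i ∈ Finset.range (lv k), q i) * g k ≤ (∏ i ∈ Finset.range (lv k), q' i) * g k := by
    intro k
    by_cases hk : lv k = 0
    · rw [hpre0 k hk, hpre0q k hk]
    · obtain ⟨m, hm⟩ := Nat.exists_eq_succ_of_ne_zero hk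
      rw [hpre1 k m hm, hpre1q k m hm]
      have hQ : 0 ≤ (∏ i ∈ Finset.range m, q (i + 1)) * g k :=
        mul_nonneg (Finset.prod_nonneg fun i _ => (hq (i + 1)).1) (hg k).1
      exact mul_le_mul_of_nonneg_right htq hQ
  have hdeep : ∀ k m, lv k = m + 1 → (∏ i ∈ Finset.range (lv k), q i) * g k = x →
      (∏ i ∈ Finset.range (lv k), q' i) * g k = g r := by
    intro k m hm hkx
    rw [hpre1 k m hm]
    rw [hpre1q k m hm] at hkx
    -- `q 0 · Q = x = q 0 · P` gives `Q = P`, and `t · P = g r`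
    have hQ : (∏ i ∈ Finset.range m, q (i + 1)) * g k = P := by
      have h1 : q 0 * ((∏ i ∈ Finset.range m, q (i + 1)) * g k) = q 0 * P := by rw [hkx, hxP]
      exact mul_left_cancel₀ hq0.ne' h1
    rw [hQ, htP]
  -- tied blobs stay tied at the new floor; `r` is tied there
  have htied' : ∀ k, 0 < a k → k ≠ s → (∏ i ∈ Finset.range (lv k), q' i) * g k = g r := by
    intro k hk hks
    by_cases hkr : k = r
    · rw [hkr, hpre0 r hr0]
    · have hk0 : lv k ≠ 0 := by
        intro h0
        rcases hroot k hk h0 with h | h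
        · exact hkr h
        · exact hks h
      obtain ⟨m, hm⟩ := Nat.exists_eq_succ_of_ne_zero hk0
      exact hdeep k m hm (htied k hk hkr hks)
  -- the budget does not drop
  have hbudget' : (2 * j : ℝ) < ∑ k, (a k : ℝ) * ((∏ i ∈ Finset.range (lv k), q' i) * g k) :=
    hbudget.trans_le (Finset.sum_le_sum fun k _ => mul_le_mul_of_nonneg_left (hmarg_mono k) (Nat.cast_nonneg _))
  -- FAR for the slid instance at the floor `g r`
  have hfar' : g r ≤ TAIL[D + 1, q', lv, a, g, j] := by
    by_cases has : 0 < a s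
    · -- all-tied except the block `s`
      have hheavy' : g r ≤ (∏ i ∈ Finset.range (lv s), q' i) * g s := by
        by_cases hs0 : lv s = 0
        · rw [hpre0 s hs0]; exact hs' has hs0
        · obtain ⟨m, hm⟩ := Nat.exists_eq_succ_of_ne_zero hs0
          rw [hpre1 s m hm]
          have h1 := hs has
          rw [hpre1q s m hm, hxP] at h1
          -- `q 0 · P ≤ q 0 · Q` ⟹ `P ≤ Q` ⟹ `t · P ≤ t · Q`
          have hPQ : P ≤ (∏ i ∈ Finset.range m, q (i + 1)) * g s := le_of_mul_le_mul_left h1 hq0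
          calc g r = t * P := htP.symm
            _ ≤ t * ((∏ i ∈ Finset.range m, q (i + 1)) * g s) := mul_le_mul_of_nonneg_left hPQ ht0.le
      exact tail_ge_of_tied_plus_one D q' hq' lv a g hg j hlv s (g r) hgr0 hx'q htied' hheavy' hbudget'
    · -- `s` is dead: every live blob is tied at `g r`, the class theorem applies
      have has0 : a s = 0 := by omega
      have hxle : ∀ k, 0 < a k → g r ≤ (∏ i ∈ Finset.range (lv k), q' i) * g k := by
        intro k hk
        have hks : k ≠ s := fun h => by rw [h, has0] at hk; exact lt_irrefl _ hk
        exact (htied' k hk hks).ge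
      have hclass : (2 * j : ℝ) < (∑ k, (a k : ℝ)) * g r := by
        refine hbudget'.trans_le (le_of_eq ?_)
        rw [Finset.sum_mul]
        refine Finset.sum_congr rfl fun k _ => ?_
        by_cases hk : 0 < a k
        · have hks : k ≠ s := fun h => by rw [h, has0] at hk; exact lt_irrefl _ hk
          rw [htied' k hk hks]
        · have : a k = 0 := by omega
          rw [this]; simp
      exact tail_ge_of_class (D + 1) q' hq' lv a g hg j hlv (g r) hxle hclass ⟨r, hr⟩
  -- the affine identity at the two gates and the monotone comparison
  have hT := tail_root_split_eq D q lv a g j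
  have hT' := tail_update_rootGate D q lv a g j t
  rw [← hq'def] at hT'
  set Φ₀ := ROOT[lv, a, g, j] with hΦ₀
  set Ψ := TAIL[D, (fun i => q (i + 1)), (fun k => lv k - 1), a, g, j] with hΨ
  have hΦ₀0 : 0 ≤ Φ₀ := root_nonneg lv a g hg j
  rw [hT]
  rw [hT'] at hfar'
  by_cases hu : x ≤ q 0 * (Ψ - Φ₀)
  · -- nonnegative slope: the root term is a bonus
    nlinarith [hΦ₀0, (hq 0).2]
  · push Not at hu
    -- negative slope: `q 0·(TAIL[q'] − x') = q 0·Φ₀ + t·(q 0(Ψ − Φ₀) − x) ≤ q 0·Φ₀ + q 0·(q 0(Ψ − Φ₀) − x) = q 0·(TAIL[q] − x)`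
    have hneg : q 0 * (Ψ - Φ₀) - x < 0 := by linarith
    have hmono : t * (q 0 * (Ψ - Φ₀) - x) ≤ q 0 * (q 0 * (Ψ - Φ₀) - x) :=
      mul_le_mul_of_nonpos_right htq hneg.le
    -- `q 0 · g r = t · x`
    have hkey : q 0 * ((1 - t) * Φ₀ + t * Ψ) - q 0 * g r = q 0 * Φ₀ + t * (q 0 * (Ψ - Φ₀) - x) := by
      rw [← htx]; ring
    have h1 : 0 ≤ q 0 * ((1 - t) * Φ₀ + t * Ψ) - q 0 * g r := by
      have := mul_le_mul_of_nonneg_left hfar' (hq 0).1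
      linarith
    have h2 : q 0 * ((1 - q 0) * Φ₀ + q 0 * Ψ) - q 0 * x = q 0 * Φ₀ + q 0 * (q 0 * (Ψ - Φ₀) - x) := by ring
    have h3 : 0 ≤ q 0 * ((1 - q 0) * Φ₀ + q 0 * Ψ) - q 0 * x := by
      rw [h2]; rw [hkey] at h1; linarith
    have h4 : q 0 * x ≤ q 0 * ((1 - q 0) * Φ₀ + q 0 * Ψ) := by linarith
    exact le_of_mul_le_mul_left h4 hq0

end BlockComb

end Quant

end Summit.CriticalPhenomena.PercolationContinuityZ3.Theorems
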